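import Mathlib
import HarnessLib
import HarnessLib.Audit
import Summits.FinalStateConjecture.Statement
import Literature.Geometry.Lorentzian.HyperboloidalDefectFoliation
import HarnessLib.Audit.Status.Attr

/-!
Route: KillingDefectSpacetimeBound

# Route KillingDefectSpacetimeBound — stationarity defect of the wave-time chart is
square-integrable in spacetime; observability, coercivity and L2-in-time capture settle one hole

It suffices to show X = R ∧ K2 ∧ K3 ∧ K1 ∧ B. R (RecurrentKerrEraWithBudgets, the ONE generic
statement): for tame-Christodoulou-generic admissible data an MGHD exists and every MGHD either
already satisfies the
Statement's conclusion or has complete 𝓘⁺ and carries, for the requested order k, a hyperboloidal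
Kerr-star foliation Ψ
(`IsHypKerrFoliation`: one horizon-penetrating chart on `Kerr.hypStarBackground M₀ a₀`,
C^(k+4)-bounded geometry, WAVE-TIME
gauge □(∂₀)♭ = 0, rays stay in the closure of its image) on which the LE-weighted Cᵏ leaf deviation
from sub-extremal Kerr
(`leafDev`, spin margin χ < 1) is RECURRENTLY small and the stationarity defect π = 𝓛_∂₀ g =
∂₀(Ψ^*g) has FINITE
local-energy size of order k+2 over the near-horizon shell and the far zone (`defectLE …
(Kerr.outerZones M₀ a₀) < ⊤`, the
two-boundary budget). K2 (DefectObservability): the photon-region LE size of π on a window is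
bounded by the outer-zone LE
size of two more derivatives of π over the whole future. K3 (DefectCoercivity): on a window the
squared leaf deviation is
bounded by the LE size of π (Łojasiewicz exponent 1/2). K1 (SquareIntegrableCapture): a foliation
whose leaf deviation is
sup-small and square-integrable in time, with small defect tails, settles down exactly as the
Statement demands (N = 1).
B glues K2, K3, K1 into "recurrence + finite budget ⇒ settles". Markdown-first sketch
killing-defect-spacetime-bound (no card).
Lean: `RecurrentKerrEraWithBudgets ∧ DefectObservability ∧ DefectCoercivity ∧
SquareIntegrableCapture ∧ BootstrapFromRecurrence`

## Assembly
`closes (hR : RecurrentKerrEraWithBudgets) (h₂ : DefectObservability) (h₃ : DefectCoercivity) (h₁ :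
SquareIntegrableCapture)
(hB : BootstrapFromRecurrence) : FinalStateConjecture` is proved in glue.lean THROUGH the Assembly
item (`have hA : Assembly := …;
exact hA hR h₂ h₃ h₁ hB`, 10 lines of logic, ClusterCompleteness pattern): hB h₂ h₃ h₁ gives an
order k and "complete ∧
structure_k ⇒ settles" for every maximal development; hR at that k gives the generic set; on it
every MGHD either settles outright
or (by contradiction) has complete 𝓘⁺ and structure_k, hence settles; tame-Christodoulou genericity
is monotone under pointwise
implication on the admissible class. Conversely `omega_of_statement : FinalStateConjecture →
RecurrentKerrEraWithBudgets`
(Sketch.lean, proved): R is a consequence of S used toward S.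

Rationale: WHY THIS LINE. The controlled quantity is new on this summit: in the wave-time gauge the
stationarity defect π = 𝓛_∂₀ g of the chart's
own time vector is an EXACT solution of the tensorial wave equation □π = −2 Riem·π on the nonlinear
vacuum spacetime
(Fischer–Marsden–Moncrief 1980, Lemma 2.2; in the tree as
`MetricCoord.IsMetricOn.tlap_deform_eq_of_tlap_eq_zero`), so the
LINEAR integrated-local-energy machinery on near-Kerr backgrounds
(DafermosRodnianskiShlapentokhrothman2014 ILED for |a| < M;
LindbladTohaneanu2020, Thm. 1: LE decay for metric PERTURBATIONS of Kerr that are only L²/L¹ in time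
near the photon region;
arXiv:2302.08916 Teukolsky in the full sub-extremal range) applies to π with no linearisation error,
and BACKWARD in time:
finite two-boundary budgets (horizon shell + far zone, the tails that answer ClusterCompleteness's
"energy hiding at large
radius") bound the photon-region defect (K2, observability with the Sbierski loss of two derivatives
built in). Coercivity
K3 is the perturbative smooth rigidity of Alexakis–Ionescu–Klainerman near Kerr read quantitatively
(d² ≤ C·‖π‖²), and K1
is capture from L²-in-time smallness (LT20's κ ∈ L²_t interface) instead of from one sup-small leaf
(the Kerr-stability black
box of QuietWindowCapture / TwoBoundarySqueeze). Imported areas: Łojasiewicz–Simon convergence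
schemes (finite dissipation +
rigidity inequality + local stability ⇒ convergence) and observability/backward estimates for waves;
native: vector-field
ILED on Kerr. Versus the negatives index (UniformPhotonSphereChannels refuted): no uniform-in-M
photon-sphere channel is
claimed; all constants depend on (k, Λ, χ, M₀, a₀).

RANKED CRUXES. #2 SquareIntegrableCapture (crux) — K1. There is an order k₁ such that for k ≥ k₁ and
all bounds (Λ, χ, M₀, a₀) there are δ₀, η > 0 with: for every admissible datum, every MAXIMAL
development, every hyperboloidal Kerr-star foliation Ψ of order k after τ₀ with rays in the closure
of its image and complete 𝓘⁺, and every τ₁ ≥ τ₀ — if the leaf deviation d_k is ≤ δ₀ after τ₁,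
∫_(τ₁,∞) d_k² ≤ η, the full LE size of π of order k after τ₁ is ≤ η and the outer-zone LE size of
order k+2 is ≤ η — the development settles to ONE sub-extremal Kerr exactly as the Statement demands
(FinalStateDecomposition with N-free conclusion verbatim, O = exteriorOf, rays, exhaustive charts,
future oriented). [difficulty: XL] (why it might fail: L²-in-time (not L¹) smallness of d_k may not
sum the (M, a, gauge) modulation drift — LT20 need κ₁ ∈ L²_t but κ₀ ∈ L¹_t; and exhaustive charts
from one chart with inner edge r(a₀) = M₀ need the final r₊ to stay above (r₊(M₀,a₀)+M₀)/2.)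
[LindbladTohaneanu2020, arXiv210408222, KlainermanSzeftel2023,
DafermosRodnianskiShlapentokhRothman2014Scattering]
#3 DefectObservability (crux) — K2 (backward observability of the stationarity defect). There is k₂
such that for k ≥ k₂ and all (Λ, χ, M₀, a₀) there are δ₀ > 0 and C with: on any hyperboloidal
Kerr-star foliation of order k and any window [τ₁, τ₂] (τ₂ ≥ τ₁ + 1) on which the leaf deviation d_k
≤ δ₀, the LE size of order k of π = ∂₀(Ψ^*g) over the MIDDLE zone (complement of `Kerr.outerZones`,
containing the photon region and ergoregion) of the window is ≤ C × the LE size of order k+2 of π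
over the OUTER zones of the whole future (τ₁, ∞). [difficulty: XL] (why it might fail: Backward
control of the trapped region from horizon-side + far-side spacetime data is an observability claim;
its constant may blow up through slowly damped quasinormal ringing as χ → 1, and π solves □π =
−2Riem·π only where the wave-time gauge holds.) [LindbladTohaneanu2020,
DafermosRodnianskiShlapentokhrothman2014, arXiv:2302.08916, FischerMarsdenMoncrief1980]
#4 DefectCoercivity (crux) — K3 (quantitative rigidity). There is k₃ such that for k ≥ k₃ and all
(Λ, χ, M₀, a₀) there are δ₀ > 0, L ≥ 4 and C with: on any foliation of order k+2 and any window [τ₁,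
τ₁+L] on which d_(k+2) ≤ δ₀, for every σ in the middle half [τ₁+L/4, τ₁+3L/4] the squared leaf
deviation d_k(σ)² is ≤ C × the full LE size of order k+2 of π over the window. [difficulty: L] (why
it might fail: Zero modes: small π forces closeness to SOME stationary vacuum region; identifying it
with Kerr on a finite window is perturbative no-hair (AIK uses the global DOC; IK local
counterexamples), and the (1+|y|)⁻² weight may under-weight far-zone mass-aspect drift, breaking
exponent 1/2.) [AlexakisIonescuKlainerman2010, arXiv:1010.2421, AnderssonHafnerWhiting2022,
Anderson2004]
#5 RecurrentKerrEraWithBudgets (crux) — R (the one generic statement, OmegaLimit device: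
Statement-or-structure). For every order k and tame-Christodoulou-generic admissible data: an MGHD
exists, and every MGHD that does not already satisfy (complete 𝓘⁺ ∧ settles) has complete 𝓘⁺ and
admits bounds (Λ, χ, M₀, a₀), a time τ₀ and a hyperboloidal Kerr-star foliation Ψ of order k in
wave-time gauge with rays in the closure of its image, on which d_k ≤ ε recurrently (∃ᶠ τ → ∞) for
every ε > 0 and the outer-zone LE size of order k+2 of π over (τ₀, ∞) is finite. [difficulty:
open-problem] (why it might fail: Packs weak cosmic censorship, generic exclusion of ≥ 2 late holes
and of extremal limits (χ < 1 recurrently; Kehle–Unger), FINITE higher-order two-boundary budgets,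
and global existence of a bounded-geometry wave-time gauge on a merely recurrently-near-Kerr end.)
[arXiv:gr-qc/9912118, KehleUnger2025, DafermosRodnianskiShlapentokhRothman2014Scattering,
AnderssonEtAl2019]
#6 BootstrapFromRecurrence (crux) — B (the Łojasiewicz–Simon loop over K2, K3, K1; a binder of
closes; kept a crux at the 2026-08-17 re-badge because it hides the instants-to-window
Cauchy-stability step and is the earliest-informative item): DefectObservability → DefectCoercivity
→ SquareIntegrableCapture → there is an order k such that every maximal development with complete 𝓘⁺
carrying an order-k foliation with rays, recurrence of small d_k and finite outer budget of order
k+2 settles as the Statement demands. Proof plan: budget tail → 0; pick τ₁ late with d small on a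
first window (recurrence + local Cauchy stability on unit bands from the C^(k+4) bounds); K2 bounds
the middle-zone defect by the tail; K3 on half-overlapping windows makes Σ d² ≤ C·tail and keeps d ≤
δ₀ (continuation); K1 concludes. [deps: DefectObservability, DefectCoercivity,
SquareIntegrableCapture] [difficulty: M] (why it might fail: Recurrence gives d_k ≤ ε at instants
only: a first small WINDOW needs a Cauchy-stability modulus for the vacuum flow in wave-time gauge,
uniform in τ, which is not an item; and K3 returns order k from k+2, so the loop must re-gain two
orders by interpolation against the C^(k+4) reserve.) [LindbladTohaneanu2020, Anderson2004,
Simon1983, RingstromCauchyProblem2009]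

TWO-LAYER PLAN. Foreseen glued splits once a crux moves (each already elaborates as a BC3 skeleton
in bc/): DefectObservability ⇐
stub_defect_wave (π = ∂₀(Ψ^*g) solves the deformation wave equation of the chart metric on the late
region: vacuum +
wave-time gauge, an index computation over `CoordDeformationWave`) → stub_backward_LE (the backward
LE estimate for ANY smooth
solution u of that equation); DefectCoercivity ⇐ stub_midzone_fit (parameter fitting + middle-zone
coercivity) →
stub_zone_transport (a re-charting good in the middle zone extends to one good on the whole band at
cost C·(mid² + defect));
SquareIntegrableCapture ⇐ stub_final_kerr (hypotheses ⇒ `ConvergesToKerr` to a sub-extremal (M, a)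
on the chart image) →
stub_settles_of_converges (ConvergesToKerr + rays + complete + future-far orientation ⇒ the
Statement's decomposition, N = 1);
RecurrentKerrEraWithBudgets ⇐ stub_kerr_era (generic: censorship + a Kerr-era foliation exists) →
stub_recurrence_budgets
(non-generic: a foliation can be re-based to one with recurrence and finite budgets unless the
development already settles).

KILL CRITERIA. Refuting DefectObservability or DefectCoercivity AS TYPED by an explicit vacuum
example (e.g. an exactly Kerr band re-charted so
that the hypotheses hold with π ≢ 0 but zero outer-zone defect, or a linearised zero-mode making d²
≫ ‖π‖²) closes the route
(`refuted:<Decl>`) unless the witness only exploits a missing normalisation (then misstated →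
repaired item). Refuting
SquareIntegrableCapture with an L²-but-not-L¹ drifting example forces the pivot "add ∫ d_k < ∞ to K1
and an L¹ output to K3"
(new items). A proof elsewhere of sub-extremal Kerr stability from one quiet leaf
(QuietWindowCapture.Capture,
TwoBoundarySqueeze) moots K1–K3 but not R.

NOT DECOMPOSED YET. Constants' dependence on χ → 1 (all cruxes are per-χ); the N ≥ 2 case
(deliberately excluded: one chart, one hole — multi-hole
ends need RecedingRepeller-type linear cruxes); the local Cauchy-stability lemma on unit bands and
the interpolation between
orders k, k+2, k+4 (inside B's proof); existence of the wave-time gauge (inside R); measurability of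
the integrands (Lebesgue
lintegral of a Borel function of iterated derivatives — routine).

CHEAPEST FALSIFIER. Exact Kerr in its own hyperboloidal Kerr-star chart: π ≡ 0, so K2 and K3 demand
d_k(σ) = 0 for every σ — true iff the identity
re-charting is admissible (`IsLeafRechart` with Φ = Ψ, M = M₀, a = a₀: smooth, injective, covers)
and `deviationExtend` of Kerr
against itself vanishes on the measured set; a refuter checks this in Lean from
`Kerr.hypStarBackground` (if d_k > 0 there, K3
is false as typed). Second: a pure-gauge re-slicing of exact Kerr violating wave-time gauge is
excluded by `IsHypKerrFoliation.waveTime`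
— check that the Kerr-star chart itself satisfies □(∂_t*)♭ = 0 (Killing ⇒ □ξ = −Ric·ξ = 0: yes).

NUMBERS. Zones: near shell r(a₀,·) ≤ 2r₊ − M₀, far zone ‖y‖ ≥ 8M₀, deep shell r(a₀,·) ≤ (r₊+M₀)/2
(inside the hole since r₊ > (r₊+M₀)/2 >
M₀ > r₋); chart inner edge r = M₀; hyperboloidal transition radius 4M₀ (`Kerr.scriHeight M a (4M)`);
LE weight (1+‖y‖)⁻²
(δ = 1 in LT20 (1.6)); derivative loss 2 (k vs k+2) at trapping (Sbierski; DRSR16 lose ε);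
regularity reserve k+4 in the foliation.

DEFINITION REQUESTS. None outstanding: the vocabulary landed as
Literature/Geometry/Lorentzian/HyperboloidalDefectFoliation.lean (p169679,
definitions only: Kerr.hypStarBackground, ModelBackground.timeBand, leWeight, leSupCkENorm,
leSqDensity, Spacetime.chartMetricDt,
timeCovector, IsWaveTimeOn, defectLE, Kerr.outerZones, IsLeafRechart, leafDev, IsHypKerrFoliation +
monotonicity lemmas).
Wanted later as cite facts (not load-bearing for typing): LT20 Thm. 1 in consequence form; DRSR14
scattering isomorphism.

Novelty: Searches (2026-08-17): lit search --hybrid "Killing vector deformation tensor wave equation vacuum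
approximate symmetry close to Kerr" (6 docs; CK book pp. 23–24 almost-Killing fields); lit search
--hybrid "local energy decay metric perturbations Kerr integrability in time trapping loss of
derivatives" (6; Daudé–Häfner–Nicolas 2017, KS2020 book); lit vsearch "approximately Killing vector
field … small in L2 is close to Kerr" (6; CK 1993 pp. 23–24, Kroon 2016 p. 192); lit search
"non-Kerrness" (5 local: arXiv:1010.2421, 1111.6019, 1211.6884, 1510.07561, 1601.04666); lit search
--hybrid "nonlinear stability Kerr full subextremal range open Teukolsky" (arXiv:2205.14808 p. 30,
arXiv:2302.08916 p. 2); lit galaxy search "approximate Killing|almost Killing|Killing defect" --star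
all (16 rows: [galaxy:panama:518737560076291] CK book, rest noise); lit galaxy search
"non-Kerrness|Killing spinor|Mars-Simon" --star all (noise); lit galaxy search
"non-Kerrness|Kerrness" --star pdf ([galaxy:pdf:2094165940] Andersson–Bäckdahl–Blue); ledger
negatives (1 entry, unrelated); 39 sibling Theses read by header.
Nearest prior art found: [corpus:paper:arxiv-2004.05664 p.2] Lindblad–Tohaneanu 2020 Thm. 1 (LE
decay for g close to Kerr with κ₁ ∈ L²_t — the capture interface of K1, for the LINEAR wave
equation); [corpus:paper:arxiv-1010.2421 p.1,3] Bäckdahl–Valiente Kroon non-Kerrness (a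
Killing-SPINOR data invariant, zero iff Kerr, no quantitative coercivity, no evolution control);
[corpus:book:christo  [refs: 1010.2421, 2205.14808, 2302.08916, paper:arxiv-2004.05664, paper:arxiv-1010.2421, book:christodoulou1993-global-nonlinear-stability-minkowski-space, FischerMarsdenMoncrief1980]

Barriers (technique_class: ILED; stationarity-defect; Killing-extension; vacuum-rigidity): - technique_class: kerr-stability, vectorfield-method, ILED, Killing-extension
- Literature.Barriers.FinalStateConjecture.SbierskiTrappingObstruction: INSIDE its class (LE
estimates through trapping) and discharged as typed — K2 loses two derivatives (order k on the
middle zone against order k+2 on the outer zones), exactly the degeneracy Sbierski's Gaussian beams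
force; no loss-free LED is claimed.
- Literature.Barriers.FinalStateConjecture.KerrSuperradiance (ergoregion_nonempty): inside (energy
methods on rotating Kerr); evaded because no statement uses positivity of the ∂_t*-energy —
`IsHypKerrFoliation` asks future-orientation of ∂₀ only in the far zone, and the estimates are bet
on the DRSR16/SR–TdC frequency-localised currents valid for all |a| < M (constants per χ).
- Literature.Barriers.FinalStateConjecture.IonescuKlainermanNonExtension: K3 is a rigidity statement
but OUTSIDE the barrier's scope — it is global on a band containing the far zone and a horizon
collar and assumes a priori C^(k+2) closeness d_(k+2) ≤ δ₀ to Kerr (the Alexakis–Ionescu–Klainerman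
perturbative regime), whereas the IK examples are local stationary extensions near one horizon point
with no asymptotic region; the bet is that perturbative rigidity is quantitative with exponent 1/2.
- Literature.Barriers.FinalStateConjecture.KerrLinearHair: outside — massive Klein–Gordon real
modes; the vacuum spin-2/1-form sectors have real-axis mode stability incl. σ = 0
(AnderssonHafnerWhiting2022), which is wha

sub-problem: FinalStateConjecture · status: draft · opened planner-type-3dbd0ee2ee-0 2026-08-17T16:51:36Z · rev 2 · ledger route-FinalStateConjecture-KillingDefectSpacetimeBound
GENERATED by the gate from the ledger (D-0016/17). Provers cite these decls: `theorem foo : Summit.FinalStateConjecture.FinalStateConjecture.Theses.KillingDefectSpacetimeBound.<Decl> := …` in Summits/FinalStateConjecture/FinalStateConjecture/Theorems/<Name>.lean.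
-/

namespace Summit.FinalStateConjecture.FinalStateConjecture.Theses.KillingDefectSpacetimeBound

open scoped BigOperators Topology Manifold Classical MeasureTheory ProbabilityTheory Matrix InnerProductSpace ComplexConjugate ContinuousMap
open Filter Set Function TopologicalSpace MeasureTheory

attribute [summit_statement] _root_.FinalStateConjecture

/-- item stmt-FinalStateConjecture-18630 · crux · rank 2 · open · by planner
why it might fail: L²-in-time (not L¹) smallness of d_k may not sum the (M, a, gauge) modulation drift — LT20 need κ₁ ∈ L²_t but κ₀ ∈ L¹_t; and exhaustive charts from one chart with inner edge r(a₀) = M₀ need the final r₊ to stay above (r₊(M₀,a₀)+M₀)/2.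
sources: LindbladTohaneanu2020, arXiv210408222, KlainermanSzeftel2023, DafermosRodnianskiShlapentokhRothman2014Scattering
[crux] K1. There is an order k₁ such that for k ≥ k₁ and all bounds (Λ, χ, M₀, a₀) there are δ₀, η >
0 with: for every admissible datum, every MAXIMAL development, every hyperboloidal Kerr-star
foliation Ψ of order k after τ₀ with rays in the closure of its image and complete 𝓘⁺, and every τ₁
≥ τ₀ — if the leaf deviation d_k is ≤ δ₀ after τ₁, ∫_(τ₁,∞) d_k² ≤ η, the full LE size of π of order
k after τ₁ is ≤ η and the outer-zone LE size of order k+2 is ≤ η — the development settles to ONE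
sub-extremal Kerr exactly as the Statement demands (FinalStateDecomposition with N-free conclusion
verbatim, O = exteriorOf, rays, exhaustive charts, future oriented). [difficulty: XL] -/
@[route_item "route-FinalStateConjecture-KillingDefectSpacetimeBound", crux]
def SquareIntegrableCapture : Prop :=
  open Literature.Geometry.Lorentzian MeasureTheory Filter in open scoped ENNReal Manifold ContDiff in ∃ k₁ : ℕ, ∀ k : ℕ, k₁ ≤ k → ∀ (Λ χ M₀ a₀ : ℝ), ∃ (δ₀ η : ℝ), 0 < δ₀ ∧ 0 < η ∧ ∀ (X : Type) [TopologicalSpace X] [ChartedSpace E3 X] [IsManifold (𝓡 3) ∞ X] [T2Space X] [SecondCountableTopology X] [ConnectedSpace X], ∀ D ∈ admissibleVacuumData X, ∀ (𝒟 : VacuumCauchyDevelopment D), 𝒟.IsMaximal → ∀ (τ₀ : ℝ) (Ψ : (Kerr.hypStarBackground M₀ a₀).domain → 𝒟.carrier), 𝒟.toSpacetime.IsHypKerrFoliation k Λ χ M₀ a₀ τ₀ Ψ → Summit.FinalStateConjecture.RaysStayInClosure 𝒟.toCauchyDevelopment (Summit.FinalStateConjecture.exteriorOf 𝒟.toCauchyDevelopment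 (Ψ '' (Kerr.hypStarBackground M₀ a₀).lateRegion τ₀)) → Summit.FinalStateConjecture.HasCompleteNullInfinity 𝒟.toCauchyDevelopment → ∀ τ₁ : ℝ, τ₀ ≤ τ₁ → (∀ τ : ℝ, τ₁ ≤ τ → 𝒟.toSpacetime.leafDev M₀ a₀ Ψ χ k τ ≤ ENNReal.ofReal δ₀) → ∫⁻ τ in Set.Ioi τ₁, 𝒟.toSpacetime.leafDev M₀ a₀ Ψ χ k τ ^ 2 ≤ ENNReal.ofReal η → 𝒟.toSpacetime.defectLE (Kerr.hypStarBackground M₀ a₀) Ψ k (Set.Ioi τ₁) Set.univ ≤ ENNReal.ofReal η → 𝒟.toSpacetime.defectLE (Kerr.hypStarBackground M₀ a₀) Ψ (k + 2) (Set.Ioi τ₁) (Kerr.outerZones M₀ a₀) ≤ ENNReal.ofReal η → (∃ (O : Set 𝒟.carrier) (d : FinalStateDecomposition 𝒟.toSpacetime O 2), (∀ i, Kerr.IsSubextremal (d.mass i) (d.spin i)) ∧ O = Summit.FinalStateConjecture.exteriorOf 𝒟.toCauchyDevelopment d.charted ∧ Summit.FinalStateConjecture.RaysStayInClosure 𝒟.toCauchyDevelopment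 O ∧ Summit.FinalStateConjecture.HasExhaustiveCharts d ∧ Summit.FinalStateConjecture.IsFutureOriented d)

/-- item stmt-FinalStateConjecture-18631 · crux · rank 3 · open · by planner
why it might fail: Backward control of the trapped region from horizon-side + far-side spacetime data is an observability claim; its constant may blow up through slowly damped quasinormal ringing as χ → 1, and π solves □π = −2Riem·π only where the wave-time gauge holds.
sources: LindbladTohaneanu2020, DafermosRodnianskiShlapentokhrothman2014, arXiv:2302.08916, FischerMarsdenMoncrief1980
[crux] K2 (backward observability of the stationarity defect). There is k₂ such that for k ≥ k₂ and
all (Λ, χ, M₀, a₀) there are δ₀ > 0 and C with: on any hyperboloidal Kerr-star foliation of order k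
and any window [τ₁, τ₂] (τ₂ ≥ τ₁ + 1) on which the leaf deviation d_k ≤ δ₀, the LE size of order k
of π = ∂₀(Ψ^*g) over the MIDDLE zone (complement of `Kerr.outerZones`, containing the photon region
and ergoregion) of the window is ≤ C × the LE size of order k+2 of π over the OUTER zones of the
whole future (τ₁, ∞). [difficulty: XL] -/
@[route_item "route-FinalStateConjecture-KillingDefectSpacetimeBound", crux]
def DefectObservability : Prop :=
  open Literature.Geometry.Lorentzian MeasureTheory Filter in open scoped ENNReal Manifold ContDiff in ∃ k₂ : ℕ, ∀ k : ℕ, k₂ ≤ k → ∀ (Λ χ M₀ a₀ : ℝ), ∃ (δ₀ C : ℝ), 0 < δ₀ ∧ ∀ (X : Type) [TopologicalSpace X] [ChartedSpace E3 X] [IsManifold (𝓡 3) ∞ X] [T2Space X] [SecondCountableTopology X] [ConnectedSpace X], ∀ D ∈ admissibleVacuumData X, ∀ (𝒟 : VacuumCauchyDevelopment D) (τ₀ : ℝ) (Ψ : (Kerr.hypStarBackground M₀ a₀).domain → 𝒟.carrier), 𝒟.toSpacetime.IsHypKerrFoliation k Λ χ M₀ a₀ τ₀ Ψ → ∀ τ₁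 τ₂ : ℝ, τ₀ ≤ τ₁ → τ₁ + 1 ≤ τ₂ → (∀ τ ∈ Set.Icc τ₁ τ₂, 𝒟.toSpacetime.leafDev M₀ a₀ Ψ χ k τ ≤ ENNReal.ofReal δ₀) → 𝒟.toSpacetime.defectLE (Kerr.hypStarBackground M₀ a₀) Ψ k (Set.Ioo τ₁ τ₂) (Kerr.outerZones M₀ a₀)ᶜ ≤ ENNReal.ofReal C * 𝒟.toSpacetime.defectLE (Kerr.hypStarBackground M₀ a₀) Ψ (k + 2) (Set.Ioi τ₁) (Kerr.outerZones M₀ a₀)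

/-- item stmt-FinalStateConjecture-18632 · crux · rank 4 · open · by planner
why it might fail: Zero modes: small π forces closeness to SOME stationary vacuum region; identifying it with Kerr on a finite window is perturbative no-hair (AIK uses the global DOC; IK local counterexamples), and the (1+|y|)⁻² weight may under-weight far-zone mass-aspect drift, breaking exponent 1/2.
sources: AlexakisIonescuKlainerman2010, arXiv:1010.2421, AnderssonHafnerWhiting2022, Anderson2004
[crux] K3 (quantitative rigidity). There is k₃ such that for k ≥ k₃ and all (Λ, χ, M₀, a₀) there are
δ₀ > 0, L ≥ 4 and C with: on any foliation of order k+2 and any window [τ₁, τ₁+L] on which d_(k+2) ≤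
δ₀, for every σ in the middle half [τ₁+L/4, τ₁+3L/4] the squared leaf deviation d_k(σ)² is ≤ C × the
full LE size of order k+2 of π over the window. [difficulty: L] -/
@[route_item "route-FinalStateConjecture-KillingDefectSpacetimeBound", crux]
def DefectCoercivity : Prop :=
  open Literature.Geometry.Lorentzian MeasureTheory Filter in open scoped ENNReal Manifold ContDiff in ∃ k₃ : ℕ, ∀ k : ℕ, k₃ ≤ k → ∀ (Λ χ M₀ a₀ : ℝ), ∃ (δ₀ L C : ℝ), 0 < δ₀ ∧ 4 ≤ L ∧ ∀ (X : Type) [TopologicalSpace X] [ChartedSpace E3 X] [IsManifold (𝓡 3) ∞ X] [T2Space X] [SecondCountableTopology X] [ConnectedSpace X], ∀ D ∈ admissibleVacuumData X, ∀ (𝒟 : VacuumCauchyDevelopment D) (τ₀ : ℝ) (Ψ : (Kerr.hypStarBackground M₀ a₀).domain → 𝒟.carrier), 𝒟.toSpacetime.IsHypKerrFoliation (k + 2) Λ χ M₀ a₀ τ₀ Ψ → ∀ τ₁ : ℝ, τ₀ ≤ τ₁ → (∀ τ ∈ Set.Icc τ₁ (τ₁ + L), 𝒟.toSpacetime.leafDev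 M₀ a₀ Ψ χ (k + 2) τ ≤ ENNReal.ofReal δ₀) → ∀ σ ∈ Set.Icc (τ₁ + L / 4) (τ₁ + 3 * L / 4), 𝒟.toSpacetime.leafDev M₀ a₀ Ψ χ k σ ^ 2 ≤ ENNReal.ofReal C * 𝒟.toSpacetime.defectLE (Kerr.hypStarBackground M₀ a₀) Ψ (k + 2) (Set.Ioo τ₁ (τ₁ + L)) Set.univ

/-- item stmt-FinalStateConjecture-18633 · crux · rank 5 · open · by planner
why it might fail: Packs weak cosmic censorship, generic exclusion of ≥ 2 late holes and of extremal limits (χ < 1 recurrently; Kehle–Unger), FINITE higher-order two-boundary budgets, and global existence of a bounded-geometry wave-time gauge on a merely recurrently-near-Kerr end.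
sources: arXiv:gr-qc/9912118, KehleUnger2025, DafermosRodnianskiShlapentokhRothman2014Scattering, AnderssonEtAl2019
[crux] R (the one generic statement, OmegaLimit device: Statement-or-structure). For every order k
and tame-Christodoulou-generic admissible data: an MGHD exists, and every MGHD that does not already
satisfy (complete 𝓘⁺ ∧ settles) has complete 𝓘⁺ and admits bounds (Λ, χ, M₀, a₀), a time τ₀ and a
hyperboloidal Kerr-star foliation Ψ of order k in wave-time gauge with rays in the closure of its
image, on which d_k ≤ ε recurrently (∃ᶠ τ → ∞) for every ε > 0 and the outer-zone LE size of order
k+2 of π over (τ₀, ∞) is finite. [difficulty: open-problem] -/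
@[route_item "route-FinalStateConjecture-KillingDefectSpacetimeBound", crux]
def RecurrentKerrEraWithBudgets : Prop :=
  open Literature.Geometry.Lorentzian MeasureTheory Filter in open scoped ENNReal Manifold ContDiff in ∀ (k : ℕ) (X : Type) [TopologicalSpace X] [ChartedSpace E3 X] [IsManifold (𝓡 3) ∞ X] [T2Space X] [SecondCountableTopology X] [ConnectedSpace X], InitialDataSet.IsTameChristodoulouGeneric (admissibleVacuumData X) (fun D ↦ (∃ 𝒟 : VacuumCauchyDevelopment D, 𝒟.IsMaximal) ∧ ∀ 𝒟 : VacuumCauchyDevelopment D, 𝒟.IsMaximal → ¬ (Summit.FinalStateConjecture.HasCompleteNullInfinity 𝒟.toCauchyDevelopment ∧ (∃ (O : Set 𝒟.carrier) (d : FinalStateDecomposition 𝒟.toSpacetime O 2), (∀ i, Kerr.IsSubextremal (d.mass i) (d.spin i)) ∧ O = Summit.FinalStateConjecture.exteriorOf 𝒟.toCauchyDevelopment d.charted ∧ Summit.FinalStateConjecture.RaysStayInClosure 𝒟.toCauchyDevelopment O ∧ Summit.FinalStateConjecture.HasExhaustiveCharts d ∧ Summit.FinalStateConjecture.IsFutureOriented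 d)) → Summit.FinalStateConjecture.HasCompleteNullInfinity 𝒟.toCauchyDevelopment ∧ (∃ (Λ χ M₀ a₀ τ₀ : ℝ) (Ψ : (Kerr.hypStarBackground M₀ a₀).domain → 𝒟.carrier), 𝒟.toSpacetime.IsHypKerrFoliation k Λ χ M₀ a₀ τ₀ Ψ ∧ Summit.FinalStateConjecture.RaysStayInClosure 𝒟.toCauchyDevelopment (Summit.FinalStateConjecture.exteriorOf 𝒟.toCauchyDevelopment (Ψ '' (Kerr.hypStarBackground M₀ a₀).lateRegion τ₀)) ∧ (∀ ε : ℝ, 0 < ε → ∃ᶠ τ in atTop, 𝒟.toSpacetime.leafDev M₀ a₀ Ψ χ k τ ≤ ENNReal.ofReal ε) ∧ 𝒟.toSpacetime.defectLE (Kerr.hypStarBackground M₀ a₀) Ψ (k + 2) (Set.Ioi τ₀) (Kerr.outerZones M₀ a₀) < ⊤)) 1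

/-- item stmt-FinalStateConjecture-18634 · crux · rank 6 · open · by planner
why it might fail: Recurrence gives d_k ≤ ε at instants only: a first small WINDOW needs a Cauchy-stability modulus for the vacuum flow in wave-time gauge, uniform in τ, which is not an item; and K3 returns order k from k+2, so the loop must re-gain two orders by interpolation against the C^(k+4) reserve.
sources: LindbladTohaneanu2020, Anderson2004, Simon1983, RingstromCauchyProblem2009
[crux] B (the Łojasiewicz–Simon loop over K2, K3, K1; a binder of closes, hence filed as a crux):
DefectObservability → DefectCoercivity → SquareIntegrableCapture → there is an order k such that
every maximal development with complete 𝓘⁺ carrying an order-k foliation with rays, recurrence of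
small d_k and finite outer budget of order k+2 settles as the Statement demands. Proof plan: budget
tail → 0; pick τ₁ late with d small on a first window (recurrence + local Cauchy stability on unit
bands from the C^(k+4) bounds); K2 bounds the middle-zone defect by the tail; K3 on half-overlapping
windows makes Σ d² ≤ C·tail and keeps d ≤ δ₀ (continuation); K1 concludes. [deps:
DefectObservability, DefectCoercivity, SquareIntegrableCapture] [difficulty: M] -/
@[route_item "route-FinalStateConjecture-KillingDefectSpacetimeBound", crux]
def BootstrapFromRecurrence : Prop :=
  open Literature.Geometry.Lorentzian MeasureTheory Filter in open scoped ENNReal Manifold ContDiff in DefectObservability → DefectCoercivity → SquareIntegrableCapture → ∃ k : ℕ, ∀ (X : Type) [TopologicalSpace X] [ChartedSpace E3 X] [IsManifold (𝓡 3) ∞ X] [T2Space X] [SecondCountableTopology X] [ConnectedSpace X], ∀ D ∈ admissibleVacuumData X, ∀ (𝒟 : VacuumCauchyDevelopment D), 𝒟.IsMaximal → Summit.FinalStateConjecture.HasCompleteNullInfinity 𝒟.toCauchyDevelopment → (∃ (Λ χ M₀ a₀ τ₀ : ℝ) (Ψ : (Kerr.hypStarBackground M₀ a₀).domain → 𝒟.carrier),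 𝒟.toSpacetime.IsHypKerrFoliation k Λ χ M₀ a₀ τ₀ Ψ ∧ Summit.FinalStateConjecture.RaysStayInClosure 𝒟.toCauchyDevelopment (Summit.FinalStateConjecture.exteriorOf 𝒟.toCauchyDevelopment (Ψ '' (Kerr.hypStarBackground M₀ a₀).lateRegion τ₀)) ∧ (∀ ε : ℝ, 0 < ε → ∃ᶠ τ in atTop, 𝒟.toSpacetime.leafDev M₀ a₀ Ψ χ k τ ≤ ENNReal.ofReal ε) ∧ 𝒟.toSpacetime.defectLE (Kerr.hypStarBackground M₀ a₀) Ψ (k + 2) (Set.Ioi τ₀) (Kerr.outerZones M₀ a₀) < ⊤) → (∃ (O : Set 𝒟.carrier) (d : FinalStateDecomposition 𝒟.toSpacetime O 2), (∀ i, Kerr.IsSubextremal (d.mass i) (d.spin i)) ∧ O = Summit.FinalStateConjecture.exteriorOf 𝒟.toCauchyDevelopment d.charted ∧ Summit.FinalStateConjecture.RaysStayInClosure 𝒟.toCauchyDevelopment O ∧ Summit.FinalStateConjecture.HasExhaustiveCharts d ∧ Summit.FinalStateConjecture.IsFutureOriented d)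

/-- item stmt-FinalStateConjecture-18635 · assembly · rank 1 · open · by planner
sources: LindbladTohaneanu2020
[assembly] RecurrentKerrEraWithBudgets → DefectObservability → DefectCoercivity →
SquareIntegrableCapture → BootstrapFromRecurrence → the Statement. -/
@[route_item "route-FinalStateConjecture-KillingDefectSpacetimeBound"]
def Assembly : Prop :=
  RecurrentKerrEraWithBudgets → DefectObservability → DefectCoercivity → SquareIntegrableCapture → BootstrapFromRecurrence → FinalStateConjecture

/-! D-0027 §2.1 — DECIDING THEOREM (planner-authored via `route open/edit --closes-file`; by planner-type-3dbd0ee2ee-0 2026-08-17T16:51:36Z):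
its hypotheses are this route's items and its conclusion the sub-problem Statement (glue_lint), and it elaborates with this file. -/

/-- DECIDING THEOREM (glue): the cruxes give the Statement, through the `Assembly` item. -/
@[closes "route-FinalStateConjecture-KillingDefectSpacetimeBound"] theorem closes (hR : RecurrentKerrEraWithBudgets) (h₂ : DefectObservability) (h₃ : DefectCoercivity)
    (h₁ : SquareIntegrableCapture) (hB : BootstrapFromRecurrence) : FinalStateConjecture := by
  have hA : Assembly := by
    intro hR h₂ h₃ h₁ hB
    obtain ⟨k, hk⟩ := hB h₂ h₃ h₁
    intro X _ _ _ _ _ _ d hd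
    obtain ⟨e, F, hF, hI, h0, hinj, hD, hE⟩ := hR k X d
      ⟨hd.1, fun hp ↦ hd.2 ⟨hp.1, fun 𝒟 hmax ↦ Classical.byContradiction fun hS ↦
        hS ⟨(hp.2 𝒟 hmax hS).1, hk X d hd.1 𝒟 hmax (hp.2 𝒟 hmax hS).1 (hp.2 𝒟 hmax hS).2⟩⟩⟩
    exact ⟨e, F, hF, hI, h0, hinj, hD, fun c hc hmem ↦
      hE c hc ⟨hmem.1, fun hp ↦ hmem.2 ⟨hp.1, fun 𝒟 hmax ↦ Classical.byContradiction fun hS ↦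
        hS ⟨(hp.2 𝒟 hmax hS).1, hk X _ hmem.1 𝒟 hmax (hp.2 𝒟 hmax hS).1 (hp.2 𝒟 hmax hS).2⟩⟩⟩⟩
  exact hA hR h₂ h₃ h₁ hB

end Summit.FinalStateConjecture.FinalStateConjecture.Theses.KillingDefectSpacetimeBound
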